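import Summits.CriticalPhenomena.CardyFormulaZ2.Theses.CardyMagicRigidity
import Literature.Probability.RandomPlanarGeometry.ImaginaryGeometryHarmonic
import Literature.Probability.RandomPlanarGeometry.SLELawOfDrivingProcess
import Literature.Probability.RandomPlanarGeometry.SLEConvergenceCriterion
import Literature.Probability.RandomPlanarGeometry.ConformalRectangle
import Literature.Probability.Percolation.InterfaceScalingLimit
import Literature.Probability.Percolation.FKLoopNestingGaussianLimit
import Literature.Probability.RandomPlanarGeometry.SLE

/-!
# Sketch — crux-ideate stmt-CriticalPhenomena-4835 (NestingRigidity), ideator 2, round 1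

First lemmas of the two crux idea cards (they must ELABORATE; they are not proved here):

* card `dobrushin-magic-martingale`: `MS24ConverseSix` (Miller–Sheffield 2016 Thm 2.4, ⇐ direction,
  at κ = 6, ρ = 0, on a general filtered probability space) and `IGHarmonicMartingaleZ2` (the
  continuum consequence of the DOMAIN magic law: every subsequential limit of the bond-ℤ² Dobrushin
  interface carries a Loewner driving process along which the κ = 6 imaginary-geometry harmonic
  functions are local martingales).
* card `ig-double-lock`: the two constant locks `IGJumpLock` (DKLM's σ² = 3/π ⇔ loop jump 2λ'(8/3) in
  GFF units) and `IGMonodromyLock` (2πχ(κ) = 2λ'(κ) iff κ = 8/3, i.e. κ' = 6).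
* glue: `X → NestingRigidity` (the crux is implied by the target; every line ends in X).
-/

noncomputable section

open MeasureTheory ProbabilityTheory Filter Set
open scoped NNReal Topology
open UpperHalfPlane (upperHalfPlaneSet)

namespace Summit.CriticalPhenomena.CardyFormulaZ2.Cruxes.NestingRigidity.Sketch

open Literature.Probability Literature.Probability.RandomPlanarGeometry
open Literature.Probability.Percolation Literature.Probability.LatticeModels

/-- Card `dobrushin-magic-martingale`, identification lever: Miller–Sheffield 2016 Thm 2.4 (⇐) at
κ = 6, ρ = 0 (no force point, so `V := W` is immaterial: the coefficient `λρ/π` vanishes). A continuous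
adapted process `W` with `W 0 = 0` for which every imaginary-geometry harmonic process
`t ↦ 𝔥_t(z) = λ − (2λ/π) arg(g_t(z) − W_t) − χ arg g_t'(z)` (κ = 6: λ = π/√6, χ = −1/√6), stopped at the
approach times of `z`, is a local martingale, is `√6 ×` a standard Brownian motion. -/
def MS24ConverseSix : Prop :=
  ∀ (Ω : Type) (mΩ : MeasurableSpace Ω) (P : Measure Ω) (𝓕 : Filtration ℝ≥0 mΩ) (W : ℝ≥0 → Ω → ℝ),
    IsProbabilityMeasure P → StronglyAdapted 𝓕 W → (∀ ω, Continuous fun t ↦ W t ω) → (∀ ω, W 0 ω = 0) →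
    (∀ z : ℂ, 0 < z.im → ∀ δ : ℝ, 0 < δ →
      IsLocalMartingale
        (stoppedProcess (fun t ω ↦ imaginaryHarmonic 6 0 (fun s ↦ W s ω) (fun s ↦ W s ω) z t)
          (fun ω ↦ Loewner.approachTime (fun s ↦ W s ω) z δ)) 𝓕 P) →
    IsBrownianReal (fun t ω ↦ W t ω / Real.sqrt 6) P

/-- Card `dobrushin-magic-martingale`, the DOMAIN MAGIC LAW in continuum-consequence form (the
transferred crux C⁺ of the card, ℤ² side): every subsequential limit `μ` of the laws of the critical
bond-ℤ² Dobrushin interfaces `bondInterface D δ` is driven (through a chordal uniformizing map `φ`) by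
a continuous adapted process `W` along which all κ = 6 imaginary-geometry harmonic processes are
local martingales. Shape copied from the tree's FK-Ising layer `exists_observableMartingale_fkInterface`. -/
def IGHarmonicMartingaleZ2 : Prop :=
  ∀ (D : DobrushinDomain) (μ : Measure (CurveClass ℂ)), IsProbabilityMeasure μ →
    IsSubseqLimitLaw (Ωδ := fun _ ↦ BondConfig (Site 2)) (fun δ ↦ bondInterface D δ)
      (fun _ ↦ bondPercolation (zdGraph 2) half) μ →
    ∀ φ : ConformalEquiv upperHalfPlaneSet D.carrier, D.IsChordalUniformizing φ →
      ∃ (W : CurveClass ℂ → ℝ≥0 → ℝ)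
        (𝓕 : Filtration ℝ≥0 (inferInstance : MeasurableSpace (CurveClass ℂ))),
        StronglyAdapted 𝓕 (fun t c ↦ W c t) ∧ (∀ c, Continuous (W c)) ∧ (∀ c, W c 0 = 0) ∧
        (∀ᵐ c ∂μ, Loewner.IsDrivenBy φ.boundaryExtension (D.pt 1) (W c) c) ∧
        ∀ z : ℂ, 0 < z.im → ∀ δ' : ℝ, 0 < δ' →
          IsLocalMartingale
            (stoppedProcess (fun t c ↦ imaginaryHarmonic 6 0 (W c) (W c) z t)
              (fun c ↦ Loewner.approachTime (W c) z δ')) 𝓕 μ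

/-- The two levers compose into the driving-process identification (shape only; the proof is the
content of the line, via Kemppainen–Smirnov regularity and Rohde–Schramm): -/
def DrivingIdentificationZ2 : Prop :=
  IGHarmonicMartingaleZ2 → MS24ConverseSix →
    ∀ (D : DobrushinDomain) (μ : Measure (CurveClass ℂ)), IsProbabilityMeasure μ →
      IsSubseqLimitLaw (Ωδ := fun _ ↦ BondConfig (Site 2)) (fun δ ↦ bondInterface D δ)
        (fun _ ↦ bondPercolation (zdGraph 2) half) μ → IsSLELaw 6 D μ

/-- Card `ig-double-lock`, lock 1 (jump): DKLM's variance at q = 1, `σ² = 3/π`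
(`dklmSigmaSq 1`), written as the height jump of one loop in units of the GFF with
`E[h(x)h(y)] ∼ −log|x−y|`, equals `2λ'` of imaginary geometry at κ = 8/3 (κ' = 6):
`√(2π/σ²) = 2π/√6 = 2 · igLambdaPrime (8/3)`. -/
def IGJumpLock : Prop :=
  Real.sqrt (2 * Real.pi / dklmSigmaSq 1) = 2 * igLambdaPrime (8 / 3)

/-- Card `ig-double-lock`, lock 2 (monodromy): among κ ∈ (0, 4), the winding monodromy `2πχ(κ)` of
the imaginary-geometry field around a closed counterflow loop equals the loop jump `2λ'(κ)` exactly
at κ = 8/3, i.e. κ' = 16/κ = 6 (from `two_pi_mul_igChi`: 2πχ = (4 − κ)λ, and λ' = πχ… = π√κ/4). -/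
def IGMonodromyLock : Prop :=
  ∀ κ : ℝ≥0, 0 < κ → κ < 4 → (2 * Real.pi * igChi κ = 2 * igLambdaPrime κ ↔ κ = 8 / 3)

/-- DKLM's twist at q = 1 is μ = 1/6, i.e. the BKW phase per oriented loop is 2πμ = π/3 — one sixth of
the winding 2π; with lock 2 (one winding = one jump) this is the statement "phase = jump/6". -/
def TwistIsOneSixth : Prop := dklmMu 1 = 1 / 6


/-! ### The locks are kernel-checkable now (cheapest falsifier of card `ig-double-lock`, passed) -/

theorem twistIsOneSixth : TwistIsOneSixth := by
  unfold TwistIsOneSixth dklmMu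
  have h13 : Real.arccos ((1 : ℝ) / 2) = Real.pi / 3 := by
    rw [← Real.cos_pi_div_three, Real.arccos_cos] <;> linarith [Real.pi_pos]
  rw [Real.sqrt_one, h13]
  field_simp
  ring

theorem dklmSigmaSq_one : dklmSigmaSq 1 = 3 / Real.pi := by
  unfold dklmSigmaSq
  have h13 : Real.arccos ((1 : ℝ) / 2) = Real.pi / 3 := by
    rw [← Real.cos_pi_div_three, Real.arccos_cos] <;> linarith [Real.pi_pos]
  rw [Real.sqrt_one, Real.arccos_neg, h13]
  have hπ : Real.pi ≠ 0 := Real.pi_ne_zero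
  field_simp
  ring

theorem igJumpLock : IGJumpLock := by
  unfold IGJumpLock
  have h83 : (0 : ℝ≥0) < 8 / 3 := by norm_num
  rw [dklmSigmaSq_one, igLambdaPrime_eq h83,
    Real.sqrt_eq_iff_mul_self_eq (by positivity) (by positivity)]
  have hc : (((8 / 3 : ℝ≥0)) : ℝ) = 8 / 3 := by norm_num
  have hs : Real.sqrt (((8 / 3 : ℝ≥0)) : ℝ) * Real.sqrt (((8 / 3 : ℝ≥0)) : ℝ) = 8 / 3 := by
    rw [Real.mul_self_sqrt (by positivity), hc]
  have hπ : Real.pi ≠ 0 := Real.pi_ne_zero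
  field_simp
  nlinarith [hs, Real.pi_pos]

theorem igMonodromyLock : IGMonodromyLock := by
  intro κ hκ _hκ4
  have hs : 0 < Real.sqrt κ := Real.sqrt_pos.2 (by exact_mod_cast hκ)
  have hsq : Real.sqrt κ * Real.sqrt κ = κ := Real.mul_self_sqrt (by exact_mod_cast hκ.le)
  have hc : (((8 / 3 : ℝ≥0)) : ℝ) = 8 / 3 := by norm_num
  rw [igLambdaPrime_eq hκ]
  unfold igChi
  have hπ : 0 < Real.pi := Real.pi_pos
  constructor
  · intro h
    have h' : (κ : ℝ) = 8 / 3 := by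
      have h2 : 2 * Real.pi * (2 / Real.sqrt κ - Real.sqrt κ / 2) * Real.sqrt κ
          = 2 * (Real.pi * Real.sqrt κ / 4) * Real.sqrt κ := by rw [h]
      have h3 : 2 * Real.pi * (2 / Real.sqrt κ - Real.sqrt κ / 2) * Real.sqrt κ
          = 2 * Real.pi * (2 - κ / 2) := by
        field_simp
        nlinarith [hsq]
      have h4 : 2 * (Real.pi * Real.sqrt κ / 4) * Real.sqrt κ = Real.pi * κ / 2 := by
        nlinarith [hsq]
      rw [h3, h4] at h2
      nlinarith [h2, hπ]
    apply NNReal.eq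
    rw [h', hc]
  · intro h
    have hk : (κ : ℝ) = 8 / 3 := by rw [h, hc]
    have key : 2 / Real.sqrt κ = 3 * Real.sqrt κ / 4 := by
      rw [div_eq_iff hs.ne']
      nlinarith [hsq, hk]
    rw [key]
    ring

/-- Glue common to every line on this crux: the target X implies the crux (the crux is
`MagicFormulaZ2 → MagicFormulaT → X`). -/
example (hX : Theses.CardyMagicRigidity.LoopLimitZ2EqT) : Theses.CardyMagicRigidity.NestingRigidity :=
  fun _ _ ↦ hX

end Summit.CriticalPhenomena.CardyFormulaZ2.Cruxes.NestingRigidity.Sketch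

end
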